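import Literature.IUT.HodgeTheaters.KitNFSideDatum
import Literature.IUT.HodgeTheaters.PMBaseKitModel
import HarnessLib

/-!
# [IUTchI] Example 4.4 (i)/(ii): evaluation-section binders need NON-INVERTIBLE endomorphisms of `𝒟_v`
# (a KIT-RULE obstruction for abc-iut-L5-t3's `PMBaseKit.EvalBinder`; proof-only, NV-register guidance)

S. Mochizuki, *Inter-universal Teichmüller theory I*, kurims manuscript (May 2020), Example 4.4 (i) p. 106 ("the
evaluation sections of `Π_v ↠ G_v` … each evaluation section has an associated label `∈ |𝔽_l|`") and (ii) p. 107
("composing with arbitrary isomorphisms") ([IUTchI] Ex 4.4 (i) p.106) [claim: Mochizuki2012, status: disputed]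
(D-0012 claim key, series status DISPUTED — kernel theorems about abc-iut's OWN hypothesis structure; nothing of the
series is asserted, no side is taken on [IUTchIII] Cor. 3.12).

abc-iut-L5-t3's `PMBaseKit.EvalBinder` (`KitNFSideDatum.lean`) packages Example 4.4's labelled classes of morphisms
between isomorphs of `𝒟_v` at the kit's bad places: closed under composition with isomorphisms on both sides, EVERY
label `j ∈ |𝔽_l|` occurring between any two isomorphs, and the label of a morphism WELL DEFINED.  This file records
the structural consequence that shapes every non-vacuity witness of the converse dictionary
`BaseThetaDatum.ofKitCore K … (E : K.EvalBinder)`: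

* `EvalBinder.false_of_forall_isIso` — if some bad place `v` has a model `𝒟_v` ALL of whose endomorphisms are
  isomorphisms, a binder cannot exist: two labels `0 ≠ [1]` both occur on `End(𝒟_v)`, and composing the label-`0`
  section with an automorphism produces the label-`[1]` section, contradicting well-definedness;
* `isEmpty_evalBinder_toyKitBad` — hence the ONE-BAD-PLACE variant of abc-iut-L5-t4's toy kit
  (`{ toyKit l hl with bad := {pt} }`, `End(𝒟_v) = ℤˣ`) carries NO `EvalBinder`: every KIT-RULE witness of
  `ofKitCore` must pass through a kit with genuinely non-invertible endomorphisms at the bad places — which is what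
  abc-iut-L5-t3's `PMBaseKit.thicken` (`KitCoreBridgeWitness.lean`: `Amb v × Thick`, `Thick = SingleObj (ℕ, +)`)
  supplies.  In print `𝒟_v = ℬ^temp(X_v)⁰` is a category of coverings, with plenty of non-invertible morphisms; the
  obstruction concerns toy interface models only.
-/

namespace Literature.IUT.HodgeTheaters

open CategoryTheory

universe u

namespace PMBaseKit

variable {l : ℕ} [Fact l.Prime] {K : PMBaseKit.{u} l}

/-- **No evaluation-section binder over a bad place whose model has only invertible endomorphisms.**  If `v ∈ 𝕍^bad`
and every endomorphism of `𝒟_v` is an isomorphism, then `K.EvalBinder` is empty: the sections of labels `0` and `[1]`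
on `End(𝒟_v)` (Ex 4.4 (i): every label occurs) differ by an automorphism, so by Ex 4.4 (ii) (closure under
composition with isomorphisms) the label-`0` class contains the label-`[1]` section — contradicting the
well-definedness of labels ([EtTh] Cor 2.9 / Rmk 4.2.1) since `[1] ≠ 0` in `|𝔽_l|`.
(KIT-RULE obstruction for [IUTchI] Ex 4.4 (i)(ii) p.106–107) [claim: Mochizuki2012, status: disputed] -/
theorem EvalBinder.false_of_forall_isIso (E : K.EvalBinder) {x : K.V} (hx : x ∈ K.bad)
    (hiso : ∀ f : K.model x ⟶ K.model x, IsIso f) : False := by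
  -- two distinct labels
  set j₁ : FlAbs l := FlStar.toFlAbs l (FlStar.mk l 1) with hj₁
  have hne : j₁ ≠ FlAbs.zero l := FlStar.toFlAbs_ne_zero l _
  -- sections of the two labels on `End(𝒟_v)`
  obtain ⟨f₀, hf₀⟩ := E.exists_section hx (FlAbs.zero l) (K.localModel x) (K.localModel x)
  obtain ⟨f₁, hf₁⟩ := E.exists_section hx j₁ (K.localModel x) (K.localModel x)
  haveI := hiso f₀
  haveI := hiso f₁
  -- the automorphism `a := f₁ ∘ f₀⁻¹` of the local model, as an isomorphism of the full subcategory
  let e : K.model x ≅ K.model x := asIso (f₁ ≫ inv f₀)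
  let a : K.localModel x ≅ K.localModel x := ObjectProperty.isoMk (K.IsLocal x) e
  have ha : a.hom.hom = f₁ ≫ inv f₀ := rfl
  -- composing the label-`0` section with `a` gives the label-`[1]` section `f₁`
  have h : E.IsEvalSection hx (FlAbs.zero l) (a.hom.hom ≫ f₀) := E.isoComp hx (FlAbs.zero l) a f₀ hf₀
  rw [ha, Category.assoc, IsIso.inv_hom_id, Category.comp_id] at h
  exact hne (E.label_unique hx f₁ hf₁ h)

/-- Contrapositive packaging: such a kit has NO `EvalBinder`. (KIT-RULE obstruction for [IUTchI] Ex 4.4 (i)(ii)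
p.106–107) [claim: Mochizuki2012, status: disputed] -/
theorem isEmpty_evalBinder_of_forall_isIso {x : K.V} (hx : x ∈ K.bad)
    (hiso : ∀ f : K.model x ⟶ K.model x, IsIso f) : IsEmpty K.EvalBinder :=
  ⟨fun E => E.false_of_forall_isIso hx hiso⟩

/-- Conversely, an `EvalBinder` forces a NON-invertible endomorphism of `𝒟_v` at every bad place.
(KIT-RULE obstruction for [IUTchI] Ex 4.4 (i)(ii) p.106–107) [claim: Mochizuki2012, status: disputed] -/
theorem EvalBinder.exists_not_isIso (E : K.EvalBinder) {x : K.V} (hx : x ∈ K.bad) :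
    ∃ f : K.model x ⟶ K.model x, ¬ IsIso f := by
  by_contra h
  exact E.false_of_forall_isIso hx fun f => by
    by_contra hf
    exact h ⟨f, hf⟩

/-! ### The one-bad-place toy kit has no evaluation-section binder -/

/-- In abc-iut-L5-t4's collage category `Model.Obj l`, every endomorphism of the local object `loc` (an element of
`ℤˣ`) is an isomorphism. (model plumbing for [IUTchI] Def 6.1 p.156) [claim: Mochizuki2012, status: disputed] -/
theorem Model.isIso_loc_endo (l : ℕ) (f : (Model.Obj.loc : Model.Obj l) ⟶ Model.Obj.loc) : IsIso f := by
  let u : ℤˣ := f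
  let g : (Model.Obj.loc : Model.Obj l) ⟶ Model.Obj.loc := (u⁻¹ : ℤˣ)
  refine ⟨⟨g, ?_, ?_⟩⟩
  · show u⁻¹ * u = 1
    exact inv_mul_cancel u
  · show u * u⁻¹ = 1
    exact mul_inv_cancel u

/-- **The ONE-BAD-PLACE toy kit carries no `EvalBinder`**: abc-iut-L5-t4's `toyKit l hl` with its unique place
declared bad (the base kit of abc-iut-L5-t3's KIT-RULE witnesses BEFORE thickening, `FKitCoreBridgeWitness.lean`)
has `𝒟_v = loc` with `End = ℤˣ`, all invertible — so `BaseThetaDatum.ofKitCore` has no instance over it; the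
witnesses of record thicken it first (`PMBaseKit.thicken`). (KIT-RULE obstruction for [IUTchI] Ex 4.4 (i)(ii)
p.106–107) [claim: Mochizuki2012, status: disputed] -/
theorem isEmpty_evalBinder_toyKitBad (l : ℕ) [Fact l.Prime] (hl : l ≠ 2) :
    IsEmpty ({ toyKit l hl with bad := ({PUnit.unit} : Finset Unit), arc := ∅ } : PMBaseKit.{0} l).EvalBinder :=
  isEmpty_evalBinder_of_forall_isIso (x := PUnit.unit) (Finset.mem_singleton_self _)
    (fun f => Model.isIso_loc_endo l f)

end PMBaseKit

end Literature.IUT.HodgeTheaters
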